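import Mathlib
import HarnessLib
import Literature.Analysis.FluidPDE.ClassicalSolution
import Literature.Analysis.FluidPDE.LerayHopf
import Literature.Analysis.FluidPDE.SuitableWeak
import Summits.NavierStokesRegularity.Statement
import Summits.NavierStokesRegularity.NavierStokesRegularity.Theses.QuarterJolt
import Summits.NavierStokesRegularity.NavierStokesRegularity.Theses.HodographBetchov
import Summits.NavierStokesRegularity.NavierStokesRegularity.Theorems.QuarterJoltEnergyJumpLaw
import Summits.NavierStokesRegularity.NavierStokesRegularity.Theorems.QuarterJoltNoTerminalJoltPosition
import Summits.NavierStokesRegularity.NavierStokesRegularity.Theorems.HodographBetchovFastClassSqueezeNoConcentration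

/-!
# Route QuarterJolt — crux `NoTerminalJolt` (stmt-NavierStokesRegularity-26463), LEAD line
# `regular_split` rev 4: POSITION of the energy-jump law — the crux implies the energy equality at
# every time of the frame and the shelf statement stmt-18118 `HodographBetchov.NoFastEnergyConcentration`

Seat ns-ntj-p1 g3 (LEAD of the crux; `--supports 26463 --as helper`), companion of
`QuarterJoltEnergyJumpLaw.lean` (the ENERGY-JUMP LAW of the Leray–Hopf class). Pure logic over landed
theorems; by-name statements for the registry's readers.

Abbreviations (each spelled out VERBATIM below): `NTJ` = `Theses.QuarterJolt.NoTerminalJolt`;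
`EE(T)` = strong `L²`-continuity of the trajectory into `T`, `‖u(t) − u(T)‖_{L²} → 0` as `t ↑ T` — for a
Leray–Hopf solution exactly the ENERGY EQUALITY AT `T` / no energy jump (`QuarterJoltEnergyJumpLaw`:
`tendsto_eLpNorm_sub_iff_tendsto_integral_norm_sub_sq`, `tendsto_integral_norm_sq_iff_…`);
`NoFastEnergyConcentration` = stmt-18118 (route HodographBetchov, crux X₁: the kinetic energy is
uniformly integrable over speed classes up to `T`); `NoTypeIBlowup` = stmt-1217; `TypeIIJolt` = stub 3 of
line `regular_split` rev 3.

* `energyEquality_of_noTerminalJolt : NTJ → (∀ frame, EE(T))` — the crux implies the energy equality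
  at EVERY time `T > 0` of every frame solution, in particular at every first blow-up time; in print
  this is known only at Type-I-in-time blow-ups (Leslie–Shvydkoy, ARMA 230 (2018) Thm. 1.2) — where, by
  the Type-I terminal jolt law (`typeI_terminalJoltLaw`, p629148), the crux itself FAILS unless there is
  no such blow-up: energy equality and terminal jolt are different things (cf. the caricature
  calibration `ssCaricature_energyContinuous_and_jolts`).
* `noFastEnergyConcentration_of_noTerminalJolt : NTJ → NoFastEnergyConcentration` (stmt-18118 BY NAME
  and VERBATIM) — a typed edge between two OPEN cruxes of different routes, through the landed
  `FastClassSqueeze.Birth.stub_no_fast_energy_concentration_of_tendsto` (strong continuity into `T` ⇒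
  no fast-energy concentration).
* `typeIIJolt_iff_typeIIEnergyEquality_and_typeIIRate` — exactness of the reshaped skeleton
  `Cruxes/NoTerminalJolt/Lines/regular_split.lean` rev 4: the Type-II half `TypeIIJolt` is EQUIVALENT
  to the conjunction of `TypeIIEnergyEquality` (a non-Type-I first blow-up in the frame has no energy
  jump: `EE(T)`) and `TypeIIRate` (given `EE(T)`, the rate: `D → 0`); with
  `NoTerminalJolt.iff_noTypeIBlowup_and_typeIIJolt` (p629677) this gives
  `iff_noTypeIBlowup_and_typeIIEnergyEquality_and_typeIIRate : NTJ ↔ NoTypeIBlowup ∧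
  TypeIIEnergyEquality ∧ TypeIIRate`.

HONEST FRAMING: implications and equivalences between OPEN statements (NTJ 26463, stmt-18118,
stmt-1217, the energy equality at a first blow-up time); nothing here proves any of them or
Navier–Stokes regularity. No summit statement is proved here. Lint note: the imports of
`Theses.HodographBetchov` / `HodographBetchovFastClassSqueezeNoConcentration` (needed to conclude
stmt-18118 BY NAME through its landed helper) carry the known `theses-cone` advisory. [folklore]
-/

noncomputable section

-- the summit and its single sub-problem share the name (CONVENTIONS §1), as in every Theorems file
set_option linter.dupNamespace false

namespace Summit.NavierStokesRegularity.NavierStokesRegularity.Theorems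

open MeasureTheory Set Function Filter Topology
open scoped NNReal ENNReal
open Literature.Analysis.FluidPDE

namespace NoTerminalJolt

/-- **`NoTerminalJolt ⇒ energy equality at every time of the frame.`** The crux BY NAME implies: for
every `ν, T > 0` and every classical solution on `[0,T)`, Leray–Hopf on `[0,T]` from a rapidly decaying
datum, the trajectory is strongly `L²`-continuous into `T` (`‖u(t) − u(T)‖_{L²} → 0`, the energy
equality at `T`; `u(T)` is the Leray–Hopf terminal value). At a first blow-up time this is the (open in
general) energy equality at the blow-up time; the crux asks for the RATE `o((T−t)^{1/4})` on top.
[folklore] -/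
theorem energyEquality_of_noTerminalJolt (h : Theses.QuarterJolt.NoTerminalJolt) :
    ∀ (ν T : ℝ), 0 < ν → 0 < T →
      ∀ (u : ℝ → EuclideanSpace ℝ (Fin 3) → EuclideanSpace ℝ (Fin 3))
        (p : ℝ → EuclideanSpace ℝ (Fin 3) → ℝ),
        Literature.Analysis.FluidPDE.IsClassicalNSSolutionOn (Set.Ico 0 T) ν 0 u p →
        Literature.Analysis.FluidPDE.IsLerayHopfOn T ν 0 (u 0) u →
        Literature.Analysis.FluidPDE.HasRapidSpatialDecay (u 0) →
        Filter.Tendsto (fun t => MeasureTheory.eLpNorm (u t - u T) 2 MeasureTheory.volume)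
          (nhdsWithin T (Set.Iio T)) (nhds 0) :=
  fun ν T hν hT u p hcl hLH hdec =>
    tendsto_eLpNorm_sub_of_tendsto_joltFunctional hT hLH (h ν T hν hT u p hcl hLH hdec)

/-- **`NoTerminalJolt ⇒ continuity of the energy at every time of the frame`** (`∫‖u(t)‖² → ∫‖u(T)‖²`
as `t ↑ T`: no energy jump). [folklore] -/
theorem energyContinuous_of_noTerminalJolt (h : Theses.QuarterJolt.NoTerminalJolt) :
    ∀ (ν T : ℝ), 0 < ν → 0 < T →
      ∀ (u : ℝ → EuclideanSpace ℝ (Fin 3) → EuclideanSpace ℝ (Fin 3))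
        (p : ℝ → EuclideanSpace ℝ (Fin 3) → ℝ),
        Literature.Analysis.FluidPDE.IsClassicalNSSolutionOn (Set.Ico 0 T) ν 0 u p →
        Literature.Analysis.FluidPDE.IsLerayHopfOn T ν 0 (u 0) u →
        Literature.Analysis.FluidPDE.HasRapidSpatialDecay (u 0) →
        Filter.Tendsto (fun t => ∫ x, ‖u t x‖ ^ 2) (nhdsWithin T (Set.Iio T))
          (nhds (∫ x, ‖u T x‖ ^ 2)) :=
  fun ν T hν hT u p hcl hLH hdec =>
    tendsto_integral_norm_sq_of_tendsto_joltFunctional hT hLH (h ν T hν hT u p hcl hLH hdec)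

/-- **`NoTerminalJolt ⇒ NoFastEnergyConcentration`** (crux stmt-26463 BY NAME ⇒ shelf statement
stmt-18118 VERBATIM): in the frame, the kinetic energy is uniformly integrable over speed classes up
to `T` — strong `L²`-continuity into `T` (`energyEquality_of_noTerminalJolt`) fed into the landed
`FastClassSqueeze.Birth.stub_no_fast_energy_concentration_of_tendsto`. A typed edge between two OPEN
cruxes of different routes; nothing is asserted about either. [folklore] -/
theorem noFastEnergyConcentration_of_noTerminalJolt' (h : Theses.QuarterJolt.NoTerminalJolt) :
    ∀ (ν T : ℝ), 0 < ν → 0 < T →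
      ∀ (u : ℝ → EuclideanSpace ℝ (Fin 3) → EuclideanSpace ℝ (Fin 3))
        (p : ℝ → EuclideanSpace ℝ (Fin 3) → ℝ),
        Literature.Analysis.FluidPDE.IsClassicalNSSolutionOn (Set.Ico 0 T) ν 0 u p →
        Literature.Analysis.FluidPDE.IsLerayHopfOn T ν 0 (u 0) u →
        Literature.Analysis.FluidPDE.HasRapidSpatialDecay (u 0) →
        ∀ ε : ℝ, 0 < ε → ∃ l : ℝ, 0 < l ∧ ∀ t ∈ Set.Ico 0 T,
          ∫⁻ x in {x : EuclideanSpace ℝ (Fin 3) | l < ‖u t x‖}, ‖u t x‖ₑ ^ 2 ≤ ENNReal.ofReal ε :=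
  fun ν T hν hT u p hcl hLH hdec =>
    FastClassSqueeze.Birth.stub_no_fast_energy_concentration_of_tendsto ν T hν hT u p hcl hLH hdec
      (energyEquality_of_noTerminalJolt h ν T hν hT u p hcl hLH hdec)

/-- **`NoTerminalJolt ⇒ HodographBetchov.NoFastEnergyConcentration`** (both cruxes BY NAME: route
QuarterJolt's stmt-26463 implies route HodographBetchov's stmt-18118). [folklore] -/
theorem noFastEnergyConcentration_of_noTerminalJolt (h : Theses.QuarterJolt.NoTerminalJolt) :
    Theses.HodographBetchov.NoFastEnergyConcentration :=
  noFastEnergyConcentration_of_noTerminalJolt' h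

/-! ### Exactness of the reshaped skeleton (rev 4): the Type-II half splits as «no energy jump» ∧ «rate» -/

/-- **`TypeIIJolt ⟺ TypeIIEnergyEquality ∧ TypeIIRate`** — exactness of the reshaped skeleton
`Cruxes/NoTerminalJolt/Lines/regular_split.lean` rev 4. `TypeIIJolt` (stub 3 of rev 3): a NON-Type-I
first blow-up in the frame has no terminal jolt. `TypeIIEnergyEquality`: such a blow-up has no energy
jump at `T` (`‖u(t) − u(T)‖_{L²} → 0`). `TypeIIRate`: such a blow-up WITH the energy equality at `T`
has no terminal jolt. `→`: the energy-jump law (`tendsto_eLpNorm_sub_of_tendsto_joltFunctional`) and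
weakening; `←`: composition. All three statements are OPEN; nothing is asserted about them. [folklore] -/
theorem typeIIJolt_iff_typeIIEnergyEquality_and_typeIIRate :
    (∀ (ν T : ℝ), 0 < ν → 0 < T →
      ∀ (u : ℝ → EuclideanSpace ℝ (Fin 3) → EuclideanSpace ℝ (Fin 3))
        (p : ℝ → EuclideanSpace ℝ (Fin 3) → ℝ),
        Literature.Analysis.FluidPDE.IsMaximalSmoothSolution ν 0 u p T →
        Literature.Analysis.FluidPDE.IsLerayHopfOn T ν 0 (u 0) u →
        Literature.Analysis.FluidPDE.HasRapidSpatialDecay (u 0) →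
        ¬ Literature.Analysis.FluidPDE.IsTypeIBlowup u T →
        Filter.Tendsto (fun t : ℝ => (Real.sqrt (T - t))⁻¹ * ∫ x, ‖u t x - u T x‖ ^ 2)
          (nhdsWithin T (Set.Iio T)) (nhds 0)) ↔
    ((∀ (ν T : ℝ), 0 < ν → 0 < T →
      ∀ (u : ℝ → EuclideanSpace ℝ (Fin 3) → EuclideanSpace ℝ (Fin 3))
        (p : ℝ → EuclideanSpace ℝ (Fin 3) → ℝ),
        Literature.Analysis.FluidPDE.IsMaximalSmoothSolution ν 0 u p T →
        Literature.Analysis.FluidPDE.IsLerayHopfOn T ν 0 (u 0) u →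
        Literature.Analysis.FluidPDE.HasRapidSpatialDecay (u 0) →
        ¬ Literature.Analysis.FluidPDE.IsTypeIBlowup u T →
        Filter.Tendsto (fun t => MeasureTheory.eLpNorm (u t - u T) 2 MeasureTheory.volume)
          (nhdsWithin T (Set.Iio T)) (nhds 0)) ∧
    (∀ (ν T : ℝ), 0 < ν → 0 < T →
      ∀ (u : ℝ → EuclideanSpace ℝ (Fin 3) → EuclideanSpace ℝ (Fin 3))
        (p : ℝ → EuclideanSpace ℝ (Fin 3) → ℝ),
        Literature.Analysis.FluidPDE.IsMaximalSmoothSolution ν 0 u p T →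
        Literature.Analysis.FluidPDE.IsLerayHopfOn T ν 0 (u 0) u →
        Literature.Analysis.FluidPDE.HasRapidSpatialDecay (u 0) →
        ¬ Literature.Analysis.FluidPDE.IsTypeIBlowup u T →
        Filter.Tendsto (fun t => MeasureTheory.eLpNorm (u t - u T) 2 MeasureTheory.volume)
          (nhdsWithin T (Set.Iio T)) (nhds 0) →
        Filter.Tendsto (fun t : ℝ => (Real.sqrt (T - t))⁻¹ * ∫ x, ‖u t x - u T x‖ ^ 2)
          (nhdsWithin T (Set.Iio T)) (nhds 0))) := by
  refine ⟨fun h => ⟨fun ν T hν hT u p hmax hLH hdec hnI => ?_,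
      fun ν T hν hT u p hmax hLH hdec hnI _ => h ν T hν hT u p hmax hLH hdec hnI⟩,
    fun h ν T hν hT u p hmax hLH hdec hnI =>
      h.2 ν T hν hT u p hmax hLH hdec hnI (h.1 ν T hν hT u p hmax hLH hdec hnI)⟩
  exact tendsto_eLpNorm_sub_of_tendsto_joltFunctional hT hLH (h ν T hν hT u p hmax hLH hdec hnI)

/-- **`NoTerminalJolt ⟺ NoTypeIBlowup ∧ TypeIIEnergyEquality ∧ TypeIIRate`** — exactness of the whole
reshaped skeleton rev 4 (regular-time half a theorem, p619494; Type-I half = stmt-1217 VERBATIM by the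
Type-I terminal jolt law, `iff_noTypeIBlowup_and_typeIIJolt`, p629677; Type-II half split by the
energy-jump law). All conjuncts are OPEN statements; nothing is asserted about them. [folklore] -/
theorem iff_noTypeIBlowup_and_typeIIEnergyEquality_and_typeIIRate :
    Theses.QuarterJolt.NoTerminalJolt ↔
      ((∀ (ν T : ℝ), 0 < ν → 0 < T →
        ∀ (u : ℝ → EuclideanSpace ℝ (Fin 3) → EuclideanSpace ℝ (Fin 3))
          (p : ℝ → EuclideanSpace ℝ (Fin 3) → ℝ),
          Literature.Analysis.FluidPDE.IsClassicalNSSolutionOn (Set.Ico 0 T) ν 0 u p →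
          Literature.Analysis.FluidPDE.IsLerayHopfOn T ν 0 (u 0) u →
          Literature.Analysis.FluidPDE.HasRapidSpatialDecay (u 0) →
          Literature.Analysis.FluidPDE.IsTypeIBlowup u T →
          Literature.Analysis.FluidPDE.HasSmoothExtensionPast ν 0 u T) ∧
      (∀ (ν T : ℝ), 0 < ν → 0 < T →
        ∀ (u : ℝ → EuclideanSpace ℝ (Fin 3) → EuclideanSpace ℝ (Fin 3))
          (p : ℝ → EuclideanSpace ℝ (Fin 3) → ℝ),
          Literature.Analysis.FluidPDE.IsMaximalSmoothSolution ν 0 u p T →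
          Literature.Analysis.FluidPDE.IsLerayHopfOn T ν 0 (u 0) u →
          Literature.Analysis.FluidPDE.HasRapidSpatialDecay (u 0) →
          ¬ Literature.Analysis.FluidPDE.IsTypeIBlowup u T →
          Filter.Tendsto (fun t => MeasureTheory.eLpNorm (u t - u T) 2 MeasureTheory.volume)
            (nhdsWithin T (Set.Iio T)) (nhds 0)) ∧
      (∀ (ν T : ℝ), 0 < ν → 0 < T →
        ∀ (u : ℝ → EuclideanSpace ℝ (Fin 3) → EuclideanSpace ℝ (Fin 3))
          (p : ℝ → EuclideanSpace ℝ (Fin 3) → ℝ),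
          Literature.Analysis.FluidPDE.IsMaximalSmoothSolution ν 0 u p T →
          Literature.Analysis.FluidPDE.IsLerayHopfOn T ν 0 (u 0) u →
          Literature.Analysis.FluidPDE.HasRapidSpatialDecay (u 0) →
          ¬ Literature.Analysis.FluidPDE.IsTypeIBlowup u T →
          Filter.Tendsto (fun t => MeasureTheory.eLpNorm (u t - u T) 2 MeasureTheory.volume)
            (nhdsWithin T (Set.Iio T)) (nhds 0) →
          Filter.Tendsto (fun t : ℝ => (Real.sqrt (T - t))⁻¹ * ∫ x, ‖u t x - u T x‖ ^ 2)
            (nhdsWithin T (Set.Iio T)) (nhds 0))) := by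
  rw [iff_noTypeIBlowup_and_typeIIJolt, typeIIJolt_iff_typeIIEnergyEquality_and_typeIIRate]

end NoTerminalJolt

end Summit.NavierStokesRegularity.NavierStokesRegularity.Theorems

end
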